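import Literature.Probability.Percolation.KozmaNitzanPreFKG
import HarnessLib

/-!
# `NoHeavyLowerTail` (stmt-CriticalPhenomena-4575) — Kozma–Nitzan's Question 7 for NESTED relay sets (any `|A|`)

Support file (new-inequality factory, prover seat `prim-ineq-prove-2`; `--supports stmt-CriticalPhenomena-4575`).
No named facts, no sorries.

Kozma–Nitzan (arXiv:2401.12397, Question 7, p. 36; inequality (41) = the pre-FKG conjecture (3) for the
minimiser of `P(a ↔ b)`): is `P(0 ↔ b, 0 ↔ A) ≥ P(0 ↔ A, c ↔ b)` when `c ∈ A` is the relay with the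
smallest `P(c ↔ b)`?  The |A| = 3 case is the open `U13` target of the factory (crux 4575, k = 3 rung).

THE THEOREM (`knQ7_of_nestedRelays`): (41) holds for EVERY finite relay set `A` — with `c` any vertex
that is no more reliable than ONE distinguished relay `a⋆ ∈ A` (`P(c ↔ b) ≤ P(a⋆ ↔ b)`) — as soon as the
observer's connection events to the relays other than `c` are NESTED into `{0 ↔ a⋆}`:
`{0 ↔ a} ⊆ {0 ↔ a⋆}` for every `a ∈ A`, `a ≠ c` (e.g. relays on a ray in which `a⋆` separates `0` from
every other relay; or `A = {a⋆, c}`, which is KN Lemma 3(i)/Theorem 1's corner).  Then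
`P((⋃_{a∈A} {0 ↔ a}) ∩ {c ↔ b}) ≤ P((⋃_{a∈A} {0 ↔ a}) ∩ {0 ↔ b})`, uniformly in `|A|`.

PROOF.  `U := ⋃_{a∈A} {0↔a}` satisfies `{0↔a⋆} ⊆ U ⊆ {0↔a⋆} ∪ {0↔c}` (if `a⋆ ∈ A`; if not, `U ⊆ {0 ↔ c}`
and both sides restrict to `{0↔c}` where `{c↔b} = {0↔b}`).  On `U ∖ {0↔a⋆}` we are inside `{0 ↔ c}`, where
`{c ↔ b} ⊆ {0 ↔ b}`; on `{0 ↔ a⋆}`, KN Lemma 3(i) (tree: `KozmaNitzan2024_lemma3_i`, with the increasing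
cluster event `Q = {0 ↔ a⋆}`) gives `P(0↔a⋆, c↔b) ≤ P(0↔a⋆, a⋆↔b)` and `{0↔a⋆} ∩ {a⋆↔b} ⊆ {0↔a⋆} ∩ {0↔b}`.
This is the `adv`-decomposition of the seat's memo (MEMO-1 §2: for |A| = 3,
`U13 = adv(Q_x) + adv(Q_y) − adv(Q_x ∩ Q_y)` with each advantage ≥ 0 by Lemma 3(i)) in the case where the
inclusion–exclusion collapses.
-/

namespace Summit.CriticalPhenomena.PercolationContinuityZ3.Theorems

open MeasureTheory Set Literature.Probability.Percolation
open Literature.Probability.LatticeModels (prodBernoulli)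
open KNPreFKG

variable {V : Type*} [Fintype V]

/-- **KN Lemma 3(i) in `Q7` form for one relay**: if `P(c ↔ b) ≤ P(a ↔ b)` then
`P(0 ↔ a, c ↔ b) ≤ P(0 ↔ a, 0 ↔ b)`. [cite: KozmaNitzan2024, Lemma 3(i) (pp. 6–7)] -/
theorem knQ7_oneRelay (w : Sym2 V → unitInterval) (o b c a : V)
    (h : (prodBernoulli w).real (openConn c b) ≤ (prodBernoulli w).real (openConn a b)) :
    (prodBernoulli w).real (openConn o a ∩ openConn c b) ≤
      (prodBernoulli w).real (openConn o a ∩ openConn o b) := by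
  classical
  have key := KozmaNitzan2024_lemma3_i w c a b le_rfl (by simpa using h)
    (KNPreFKG.isUpperSet_connFamily a o)
  rw [← KNPreFKG.openConn_eq_setOf_connFamily, zero_mul, add_zero, KNPreFKG.openConn_symm a o] at key
  -- key : μ.real (openConn c b ∩ openConn o a) ≤ μ.real (openConn a b ∩ openConn o a)
  rw [inter_comm] at key
  refine key.trans ?_
  rw [inter_comm]
  refine measureReal_mono ?_
  rintro ω ⟨hoa, hab⟩
  exact ⟨hoa, SimpleGraph.Reachable.trans hoa hab⟩

/-- **Kozma–Nitzan Question 7 for nested relay sets (any `|A|`).**  If `P(c ↔ b) ≤ P(a⋆ ↔ b)` and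
`{0 ↔ a} ⊆ {0 ↔ a⋆}` for every `a ∈ A` with `a ≠ c`, then
`P((⋃_{a∈A} {0↔a}) ∩ {c↔b}) ≤ P((⋃_{a∈A} {0↔a}) ∩ {0↔b})`. [cite: KozmaNitzan2024, Question 7 (p. 36), Lemma 3(i) (pp. 6–7)] -/
theorem knQ7_of_nestedRelays (w : Sym2 V → unitInterval) (A : Finset V) (o b c aTop : V)
    (haTop : aTop ∈ A)
    (hworst : (prodBernoulli w).real (openConn c b) ≤ (prodBernoulli w).real (openConn aTop b))
    (hnest : ∀ a ∈ A, a ≠ c → (openConn o a : Set (BondConfig V)) ⊆ openConn o aTop) :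
    (prodBernoulli w).real ((⋃ a ∈ A, openConn o a) ∩ openConn c b) ≤
      (prodBernoulli w).real ((⋃ a ∈ A, openConn o a) ∩ openConn o b) := by
  classical
  set μ := prodBernoulli w with hμ
  set U : Set (BondConfig V) := ⋃ a ∈ A, openConn o a with hU
  set Qt : Set (BondConfig V) := openConn o aTop with hQt
  have hQU : Qt ⊆ U := by
    intro ω hω
    rw [hU, mem_iUnion₂]
    exact ⟨aTop, haTop, hω⟩
  -- the part of `U` outside `{0 ↔ a⋆}` lies inside `{0 ↔ c}`
  have hout : ∀ ω ∈ U \ Qt, ω ∈ (openConn o c : Set (BondConfig V)) := by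
    rintro ω ⟨hωU, hωQ⟩
    rw [hU, mem_iUnion₂] at hωU
    obtain ⟨a, haA, hωa⟩ := hωU
    by_cases hac : a = c
    · exact hac ▸ hωa
    · exact absurd (hnest a haA hac hωa) hωQ
  -- split `U ∩ {c ↔ b}` along `Qt`; outside `Qt` we are in `{0 ↔ c}`, where `{c ↔ b} ⊆ {0 ↔ b}`
  have hsub : U ∩ openConn c b ⊆ (Qt ∩ openConn c b) ∪ ((U \ Qt) ∩ openConn o b) := by
    rintro ω ⟨hωU, hcb⟩
    by_cases hωQ : ω ∈ Qt
    · exact Or.inl ⟨hωQ, hcb⟩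
    · refine Or.inr ⟨⟨hωU, hωQ⟩, ?_⟩
      have hoc : ω ∈ (openConn o c : Set (BondConfig V)) := hout ω ⟨hωU, hωQ⟩
      exact SimpleGraph.Reachable.trans hoc hcb
  have h1 : μ.real (U ∩ openConn c b) ≤
      μ.real (Qt ∩ openConn c b) + μ.real ((U \ Qt) ∩ openConn o b) :=
    (measureReal_mono hsub).trans (measureReal_union_le _ _)
  -- on `Qt`: Lemma 3(i)
  have h2 : μ.real (Qt ∩ openConn c b) ≤ μ.real (Qt ∩ openConn o b) :=
    knQ7_oneRelay w o b c aTop hworst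
  -- reassemble the disjoint pieces of `U ∩ {0 ↔ b}`
  have hdisj : Disjoint (Qt ∩ openConn o b) ((U \ Qt) ∩ openConn o b) := by
    rw [Set.disjoint_left]
    rintro ω ⟨hωQ, -⟩ ⟨⟨-, hωQ'⟩, -⟩
    exact hωQ' hωQ
  have hunion : (Qt ∩ openConn o b) ∪ ((U \ Qt) ∩ openConn o b) = U ∩ openConn o b := by
    ext ω
    constructor
    · rintro (⟨hωQ, hob⟩ | ⟨⟨hωU, -⟩, hob⟩)
      · exact ⟨hQU hωQ, hob⟩
      · exact ⟨hωU, hob⟩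
    · rintro ⟨hωU, hob⟩
      by_cases hωQ : ω ∈ Qt
      · exact Or.inl ⟨hωQ, hob⟩
      · exact Or.inr ⟨⟨hωU, hωQ⟩, hob⟩
  have h3 : μ.real (Qt ∩ openConn o b) + μ.real ((U \ Qt) ∩ openConn o b) = μ.real (U ∩ openConn o b) := by
    rw [← measureReal_union hdisj MeasurableSet.of_discrete, hunion]
  calc μ.real (U ∩ openConn c b)
      ≤ μ.real (Qt ∩ openConn c b) + μ.real ((U \ Qt) ∩ openConn o b) := h1
    _ ≤ μ.real (Qt ∩ openConn o b) + μ.real ((U \ Qt) ∩ openConn o b) := by linarith [h2]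
    _ = μ.real (U ∩ openConn o b) := h3

end Summit.CriticalPhenomena.PercolationContinuityZ3.Theorems
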